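import Literature.NumberTheory.Automorphic.IdeleClassGroupUnitMaps
import Literature.Topology.Algebra.ProperCompactSupRange
import Mathlib.NumberTheory.NumberField.InfiniteAdeleRing
import Mathlib.Topology.MetricSpace.ProperSpace
import Mathlib.Analysis.Normed.Group.Uniform
import Mathlib.Analysis.Complex.Circle
import HarnessLib

/-!
# The norm-one torus and the polar decomposition of `K_∞ˣ`; the subgroups `f(A)·[T]` of `C_K`

Topic `NumberTheory/Automorphic`; namespace `Literature.NumberTheory.Automorphic` (sub-namespaces
`InfiniteAdeleRing`, `IdeleClassGroup`). `K` a number field, `K_∞ = InfiniteAdeleRing K`,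
`C_K = IdeleClassGroup K`, `[·] : K_∞ˣ → C_K` the tree's `infUnitsToClass`.

* `InfiniteAdeleRing.normOneTorus K ≤ K_∞ˣ` — the infinite ideles all of whose components have norm
  one (`≅ ∏_{v real} {±1} × ∏_{v complex} S¹`); **compact** (`isCompact_normOneTorus`, parametrised
  by the product of the unit spheres, `torusParam`);
* `InfiniteAdeleRing.posRealUnits K ≤ K_∞ˣ` — all components positive reals (under
  `extensionEmbedding v : K_v → ℂ`); **polar decomposition** `exists_posReal_mul_normOne`:
  `u = p · t`, `p ∈ posRealUnits`, `t ∈ normOneTorus` (`z = |z|·(z/|z|)` componentwise), i.e.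
  `posRealUnits ⊔ normOneTorus = ⊤`;
* `IdeleClassGroup.torusToClass`, `IdeleClassGroup.posRealToClass` — the two subgroups mapped to
  `C_K`; `range_infUnitsToClass_le : [K_∞ˣ] ≤ [posRealUnits] ⊔ [T]`, and
  `hpolar_of_posRealUnits_le`: if `[posRealUnits] ≤ f(A)` then `[K_∞ˣ] ≤ f(A) ⊔ [T]`;
* **`IdeleClassGroup.isClosed_range_sup_torusToClass`**: for every PROPER continuous homomorphism
  `f : A →* C_K` the subgroup `f(A) ⊔ [T]` is closed, and
  **`IdeleClassGroup.continuous_char_range_sup_torus_iff`**: a homomorphism out of it is continuous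
  iff its pull-backs to `A` and to `T` are (`Literature/Topology/Algebra/ProperCompactSupRange.lean`
  with the compact factor `T`).

(The tree's `IdeleClassGroup.posReal K ≤ C_K` — classes of the DIAGONAL positive real ideles
`posRealIdele r` — is the image of the diagonal of `posRealUnits`; not used here.) Standard
(A. Weil, *Basic Number Theory*, Ch. IV §4; J. W. S. Cassels in Cassels–Fröhlich, Ch. II §§16–18
[WeilBNT1967, CasselsFrohlichANT1967]); everything is proved.

## Provenance

Reproduced for the tree under the LEAN-IN-TREE rule (2026-08-18) from the pub-hodgecm cell's
package files `HodgeCM/PerL34/NormOneTorus.lean` (175 lines) and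
`HodgeCM/PerL34/PolarDecomposition.lean` (144 lines) (DAG-node prover #10 lineage, seat pv10, gate
run 22), re-based on the tree's `IdeleClassGroup K` / `infUnitsToClass` (`NumberField.X` ↦
`Literature.NumberTheory.Automorphic.{InfiniteAdeleRing, IdeleClassGroup}.X`), otherwise verbatim
with added docstrings.
-/

set_option autoImplicit false

noncomputable section

open _root_.Topology
open NumberField NumberField.InfinitePlace NumberField.InfinitePlace.Completion

namespace Literature.NumberTheory.Automorphic

section infinite

variable (K : Type*) [Field K]

namespace InfiniteAdeleRing

/-! ## The norm-one torus -/

/-- The unit sphere of the completion at an infinite place is compact (isometric closed embedding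
into `ℂ`). [folklore] -/
theorem isCompact_sphere_completion (v : InfinitePlace K) :
    IsCompact (Metric.sphere (0 : v.Completion) 1) := by
  have hφ : Isometry (extensionEmbedding v) := isometry_extensionEmbedding v
  have hce : IsClosedEmbedding (extensionEmbedding v) := hφ.isClosedEmbedding
  have hset : Metric.sphere (0 : v.Completion) 1 =
      extensionEmbedding v ⁻¹' Metric.sphere (0 : ℂ) 1 := by
    ext x
    simp only [Set.mem_preimage, mem_sphere_zero_iff_norm]
    rw [hφ.norm_map_of_map_zero (map_zero _)]
  rw [hset]
  exact hce.isCompact_preimage (isCompact_sphere 0 1)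

/-- `CompactSpace` form of `isCompact_sphere_completion`. [folklore] -/
instance compactSpace_sphere_completion (v : InfinitePlace K) :
    CompactSpace (Metric.sphere (0 : v.Completion) 1) :=
  isCompact_iff_compactSpace.mp (isCompact_sphere_completion K v)

/-- `(u⁻¹)_v = (u_v)⁻¹`. [folklore] -/
theorem inv_apply (u : (InfiniteAdeleRing K)ˣ) (v : InfinitePlace K) :
    (↑u⁻¹ : InfiniteAdeleRing K) v = ((u : InfiniteAdeleRing K) v)⁻¹ := by
  have h : (↑u⁻¹ : InfiniteAdeleRing K) v * (u : InfiniteAdeleRing K) v = 1 :=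
    congrArg (fun x : InfiniteAdeleRing K => x v) u.inv_mul
  exact eq_inv_of_mul_eq_one_left h

/-- **The norm-one torus** `T = {u ∈ K_∞ˣ | ‖u_v‖ = 1 for all v}`. [cite: WeilBNT1967, Ch. IV §4] -/
def normOneTorus : Subgroup (InfiniteAdeleRing K)ˣ where
  carrier := {u | ∀ v : InfinitePlace K, ‖(u : InfiniteAdeleRing K) v‖ = 1}
  mul_mem' {a b} ha hb v := by
    have h : ((a * b : (InfiniteAdeleRing K)ˣ) : InfiniteAdeleRing K) v =
        (a : InfiniteAdeleRing K) v * (b : InfiniteAdeleRing K) v := rfl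
    rw [Set.mem_setOf_eq] at ha hb
    rw [h, norm_mul, ha v, hb v, one_mul]
  one_mem' v := by
    have h : ((1 : (InfiniteAdeleRing K)ˣ) : InfiniteAdeleRing K) v = 1 := rfl
    rw [h, norm_one]
  inv_mem' {a} ha v := by
    rw [Set.mem_setOf_eq] at ha
    rw [inv_apply, norm_inv, ha v, inv_one]

/-- Membership in the norm-one torus. [folklore] -/
theorem mem_normOneTorus (u : (InfiniteAdeleRing K)ˣ) :
    u ∈ normOneTorus K ↔ ∀ v : InfinitePlace K, ‖(u : InfiniteAdeleRing K) v‖ = 1 :=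
  Iff.rfl

/-- Parametrisation of the torus by the product of the unit spheres. [folklore] -/
def torusParam (s : ∀ v : InfinitePlace K, Metric.sphere (0 : v.Completion) 1) :
    (InfiniteAdeleRing K)ˣ where
  val := fun v => (s v : v.Completion)
  inv := fun v => ((s v : v.Completion))⁻¹
  val_inv := by
    funext v
    exact mul_inv_cancel₀ (ne_zero_of_mem_unit_sphere (s v))
  inv_val := by
    funext v
    exact inv_mul_cancel₀ (ne_zero_of_mem_unit_sphere (s v))

/-- Components of `torusParam s`. [folklore] -/
@[simp] theorem torusParam_apply (s : ∀ v : InfinitePlace K, Metric.sphere (0 : v.Completion) 1)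
    (v : InfinitePlace K) : (torusParam K s : InfiniteAdeleRing K) v = s v := rfl

/-- `torusParam` is continuous. [folklore] -/
theorem continuous_torusParam : Continuous (torusParam K) := by
  rw [Units.continuous_iff]
  constructor
  · exact continuous_pi fun v => continuous_subtype_val.comp (continuous_apply v)
  · show Continuous fun s : (∀ v : InfinitePlace K, Metric.sphere (0 : v.Completion) 1) =>
      fun v => ((s v : v.Completion))⁻¹
    exact continuous_pi fun v =>
      (continuous_subtype_val.comp (continuous_apply v)).inv₀
        fun s => ne_zero_of_mem_unit_sphere (s v)

/-- The image of `torusParam` is the norm-one torus. [folklore] -/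
theorem range_torusParam :
    Set.range (torusParam K) = (normOneTorus K : Set (InfiniteAdeleRing K)ˣ) := by
  ext u
  constructor
  · rintro ⟨s, rfl⟩ v
    rw [torusParam_apply]
    exact norm_eq_of_mem_sphere (s v)
  · intro hu
    exact ⟨fun v => ⟨(u : InfiniteAdeleRing K) v, mem_sphere_zero_iff_norm.mpr (hu v)⟩,
      Units.ext rfl⟩

/-- **`T` is compact.** [cite: WeilBNT1967, Ch. IV §4] -/
theorem isCompact_normOneTorus : IsCompact (normOneTorus K : Set (InfiniteAdeleRing K)ˣ) := by
  rw [← range_torusParam]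
  exact isCompact_range (continuous_torusParam K)

/-- `CompactSpace` form of `isCompact_normOneTorus`. [folklore] -/
instance compactSpace_normOneTorus : CompactSpace (normOneTorus K) :=
  isCompact_iff_compactSpace.mp (isCompact_normOneTorus K)

/-! ## Positive real units and the polar decomposition -/

/-- Every real number is a value of `extensionEmbedding v` (onto `ℝ` at real `v`, onto `ℂ` at
complex `v`). [folklore] -/
theorem exists_extensionEmbedding_eq_ofReal (v : InfinitePlace K) (r : ℝ) :
    ∃ x : v.Completion, extensionEmbedding v x = (r : ℂ) := by
  rcases isReal_or_isComplex v with hv | hv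
  · obtain ⟨x, hx⟩ := surjective_extensionEmbeddingOfIsReal hv r
    exact ⟨x, by rw [← extensionEmbeddingOfIsReal_apply hv x, hx]⟩
  · exact surjective_extensionEmbedding_of_isComplex hv (r : ℂ)

/-- `extensionEmbedding v` preserves norms. [folklore] -/
theorem norm_extensionEmbedding (v : InfinitePlace K) (x : v.Completion) :
    ‖extensionEmbedding v x‖ = ‖x‖ :=
  (isometry_extensionEmbedding v).norm_map_of_map_zero (map_zero _) x

/-- **Positive real ideles at infinity**: all components are positive reals.
[cite: WeilBNT1967, Ch. IV §4] -/
def posRealUnits : Subgroup (InfiniteAdeleRing K)ˣ where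
  carrier := {u | ∀ v : InfinitePlace K, ∃ r : ℝ, 0 < r ∧
    extensionEmbedding v ((u : InfiniteAdeleRing K) v) = (r : ℂ)}
  mul_mem' {a b} ha hb v := by
    obtain ⟨r, hr, hra⟩ := ha v
    obtain ⟨s, hs, hsb⟩ := hb v
    refine ⟨r * s, mul_pos hr hs, ?_⟩
    have h : ((a * b : (InfiniteAdeleRing K)ˣ) : InfiniteAdeleRing K) v =
        (a : InfiniteAdeleRing K) v * (b : InfiniteAdeleRing K) v := rfl
    rw [h, map_mul, hra, hsb, Complex.ofReal_mul]
  one_mem' v := by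
    refine ⟨1, one_pos, ?_⟩
    have h : ((1 : (InfiniteAdeleRing K)ˣ) : InfiniteAdeleRing K) v = 1 := rfl
    rw [h, map_one, Complex.ofReal_one]
  inv_mem' {a} ha v := by
    obtain ⟨r, hr, hra⟩ := ha v
    refine ⟨r⁻¹, inv_pos.mpr hr, ?_⟩
    rw [inv_apply, map_inv₀, hra, Complex.ofReal_inv]

/-- Membership in `posRealUnits`. [folklore] -/
theorem mem_posRealUnits (u : (InfiniteAdeleRing K)ˣ) :
    u ∈ posRealUnits K ↔ ∀ v : InfinitePlace K, ∃ r : ℝ, 0 < r ∧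
      extensionEmbedding v ((u : InfiniteAdeleRing K) v) = (r : ℂ) :=
  Iff.rfl

/-- **Polar decomposition `z = |z| · (z/|z|)`, componentwise**: every infinite idele is a positive
real one times a norm-one one. [cite: WeilBNT1967, Ch. IV §4] -/
theorem exists_posReal_mul_normOne (u : (InfiniteAdeleRing K)ˣ) :
    ∃ p ∈ posRealUnits K, ∃ t ∈ normOneTorus K, u = p * t := by
  classical
  -- components of a unit of `K_∞` are nonzero (tree:
  -- `GaloisRepresentations.InfiniteIdele.coe_apply_ne_zero`, not imported to keep the cone light)
  have hune : ∀ v : InfinitePlace K, (u : InfiniteAdeleRing K) v ≠ 0 := fun v =>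
    (Units.map (Pi.evalRingHom (fun w : InfinitePlace K => w.Completion) v).toMonoidHom u).ne_zero
  -- the modulus idele `p` with `p_v ↦ ‖u_v‖`
  have hex : ∀ v : InfinitePlace K, ∃ x : v.Completion,
      extensionEmbedding v x = ((‖(u : InfiniteAdeleRing K) v‖ : ℝ) : ℂ) :=
    fun v => exists_extensionEmbedding_eq_ofReal K v _
  choose ρ hρ using hex
  have hρnorm : ∀ v, ‖ρ v‖ = ‖(u : InfiniteAdeleRing K) v‖ := by
    intro v
    rw [← norm_extensionEmbedding K v (ρ v), hρ v, Complex.norm_real, norm_norm]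
  have hρne : ∀ v, ρ v ≠ 0 := by
    intro v h
    have := hρnorm v
    rw [h, norm_zero] at this
    exact norm_ne_zero_iff.mpr (hune v) this.symm
  let p : (InfiniteAdeleRing K)ˣ :=
    ⟨fun v => ρ v, fun v => (ρ v)⁻¹, funext fun v => mul_inv_cancel₀ (hρne v),
      funext fun v => inv_mul_cancel₀ (hρne v)⟩
  have hp : ∀ v, (p : InfiniteAdeleRing K) v = ρ v := fun v => rfl
  refine ⟨p, fun v => ⟨‖(u : InfiniteAdeleRing K) v‖, norm_pos_iff.mpr (hune v), ?_⟩,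
    p⁻¹ * u, fun v => ?_, by rw [mul_inv_cancel_left]⟩
  · rw [hp, hρ v]
  · have h : ((p⁻¹ * u : (InfiniteAdeleRing K)ˣ) : InfiniteAdeleRing K) v =
        (↑p⁻¹ : InfiniteAdeleRing K) v * (u : InfiniteAdeleRing K) v := rfl
    rw [h, inv_apply, hp, norm_mul, norm_inv, hρnorm v,
      inv_mul_cancel₀ (norm_ne_zero_iff.mpr (hune v))]

/-- As subgroups: `K_∞ˣ = posRealUnits · normOneTorus`. [cite: WeilBNT1967, Ch. IV §4] -/
theorem posRealUnits_sup_normOneTorus : posRealUnits K ⊔ normOneTorus K = ⊤ := by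
  rw [eq_top_iff]
  intro u _
  obtain ⟨p, hp, t, ht, rfl⟩ := exists_posReal_mul_normOne K u
  exact Subgroup.mul_mem _ (Subgroup.mem_sup_left hp) (Subgroup.mem_sup_right ht)

end InfiniteAdeleRing

end infinite

/-! ## The subgroups `[T]`, `[posRealUnits]`, `f(A) ⊔ [T]` of `C_K` -/

open InfiniteAdeleRing

namespace IdeleClassGroup

variable (K : Type) [Field K] [NumberField K]

/-- The norm-one torus mapped to the idele class group: `T →* C_K`. [folklore] -/
def torusToClass : normOneTorus K →* IdeleClassGroup K :=
  (infUnitsToClass K).comp (normOneTorus K).subtype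

/-- Unfolding `torusToClass`. [folklore] -/
theorem torusToClass_apply (t : normOneTorus K) :
    torusToClass K t = infUnitsToClass K (t : (InfiniteAdeleRing K)ˣ) := rfl

/-- `torusToClass` is continuous. [folklore] -/
theorem continuous_torusToClass : Continuous (torusToClass K) :=
  (continuous_infUnitsToClass K).comp continuous_subtype_val

/-- The positive-real idele classes: `posRealUnits →* C_K`. [folklore] -/
def posRealToClass : posRealUnits K →* IdeleClassGroup K :=
  (infUnitsToClass K).comp (posRealUnits K).subtype

/-- Unfolding `posRealToClass`. [folklore] -/
theorem posRealToClass_apply (p : posRealUnits K) :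
    posRealToClass K p = infUnitsToClass K (p : (InfiniteAdeleRing K)ˣ) := rfl

/-- **`[K_∞ˣ] ≤ [positive reals] ⊔ [norm-one torus]`** in `C_K`. [folklore] -/
theorem range_infUnitsToClass_le :
    (infUnitsToClass K).range ≤ (posRealToClass K).range ⊔ (torusToClass K).range := by
  rintro _ ⟨u, rfl⟩
  obtain ⟨p, hp, t, ht, rfl⟩ := exists_posReal_mul_normOne K u
  rw [map_mul]
  exact Subgroup.mul_mem _ (Subgroup.mem_sup_left ⟨⟨p, hp⟩, rfl⟩)
    (Subgroup.mem_sup_right ⟨⟨t, ht⟩, rfl⟩)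

/-- If the positive-real idele classes lie in `f(A)`, then every infinite idele class is an
`f(A)`-class times a norm-one class: `[K_∞ˣ] ≤ f(A) ⊔ [T]`. [folklore] -/
theorem hpolar_of_posRealUnits_le {A : Type*} [Group A] (f : A →* IdeleClassGroup K)
    (hpos : (posRealToClass K).range ≤ f.range) :
    (infUnitsToClass K).range ≤ f.range ⊔ (torusToClass K).range :=
  (range_infUnitsToClass_le K).trans (sup_le_sup_right hpos _)

/-- **`f(A) ⊔ [T]` is closed in `C_K`** for every PROPER continuous homomorphism `f : A →* C_K`
(`Literature.Topology.Algebra.MonoidHom.isClosed_range_sup_range`, `T` compact).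
[cite: HewittRoss1979, (5.18)] -/
theorem isClosed_range_sup_torusToClass {A : Type*} [Group A] [TopologicalSpace A]
    (f : A →* IdeleClassGroup K) (hf : IsProperMap f) :
    IsClosed ((f.range ⊔ (torusToClass K).range : Subgroup (IdeleClassGroup K)) :
      Set (IdeleClassGroup K)) := by
  have h := Literature.Topology.Algebra.MonoidHom.isClosed_range_sup_range
    (C := IdeleClassGroup K) f (torusToClass K) hf (continuous_torusToClass K)
  exact h

/-- A homomorphism out of `f(A) ⊔ [T]` (`f` proper, continuous) into a topological monoid is
continuous iff its pull-backs to `A` and to the torus `T` are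
(`Literature.Topology.Algebra.MonoidHom.continuous_char_sup_range_iff`). [folklore] -/
theorem continuous_char_range_sup_torus_iff {A : Type*} [Group A] [TopologicalSpace A]
    (f : A →* IdeleClassGroup K) (hf : IsProperMap f)
    {M : Type*} [Monoid M] [TopologicalSpace M] [ContinuousMul M]
    (χ : (f.range ⊔ (torusToClass K).range : Subgroup (IdeleClassGroup K)) →* M) :
    Continuous χ ↔
      Continuous (fun a : A => χ ⟨f a, Subgroup.mem_sup_left ⟨a, rfl⟩⟩) ∧
      Continuous (fun t : normOneTorus K =>
        χ ⟨torusToClass K t, Subgroup.mem_sup_right ⟨t, rfl⟩⟩) := by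
  have h := Literature.Topology.Algebra.MonoidHom.continuous_char_sup_range_iff
    (C := IdeleClassGroup K) f (torusToClass K) hf (continuous_torusToClass K) χ
  exact h

end IdeleClassGroup

end Literature.NumberTheory.Automorphic

end
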